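import Mathlib
import Summits.NavierStokesRegularity.NavierStokesRegularity.Theorems.TaoLadderRungThreeLocalDynamicsSufficesAt
import Summits.NavierStokesRegularity.NavierStokesRegularity.Theses.CompletionRelayChain
import HarnessLib

/-!
# `CompletionRelayChain.LocalDynamicsSufficesAt` (item stmt-NavierStokesRegularity-24854;
  host support)

The support `LocalDynamicsSufficesAt` of route `CompletionRelayChain` is, character for character,
the shared support `LocalDynamicsSufficesAt` of routes `TaoLadderRungThree` /
`HeteroclinicTriggerChain` / `TrappingWindowRungThree` (items stmt-NavierStokesRegularity-20426 /
21752), already proved in the tree as `Theorems.LocalDynamicsSufficesAt.noGlobalCascade_of_local`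
(file `TaoLadderRungThreeLocalDynamicsSufficesAt.lean`): for `ε₀ > 0` and `R ≥ 1`,
`DynamicsLocalAt ε₀ R` yields a table `α ∈ InTableClass R` and a datum `X₀` with
`NoGlobalCascade ε₀ α X₀`. This file closes the new item by that theorem.

HONEST FRAMING: definitional bookkeeping about Tao-type MODEL lattice pseudo-flows (Tao 2016 §6);
nothing here is a statement about the Navier–Stokes equations, and the route's rung leaf
(`TaoLadderRungThree.TargetR64`, TL-M3-R64) is not the summit Statement.
-/

noncomputable section

set_option linter.dupNamespace false

namespace Summit.NavierStokesRegularity.NavierStokesRegularity.Theorems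

open LocalDynamicsSufficesAt in
/-- **Item stmt-NavierStokesRegularity-24854** (`CompletionRelayChain.LocalDynamicsSufficesAt`):
for `ε₀ > 0` and `R ≥ 1`, `DynamicsLocalAt ε₀ R` gives `α ∈ InTableClass R` and `X₀` with
`NoGlobalCascade ε₀ α X₀`, closed by the tree theorem
`LocalDynamicsSufficesAt.noGlobalCascade_of_local`.
[cite: Tao2016AveragedNS, §6.2 p. 32 with §6.1 p. 31] -/
theorem completionRelayChain_localDynamicsSufficesAt_proof :
    Summit.NavierStokesRegularity.NavierStokesRegularity.Theses.CompletionRelayChain.LocalDynamicsSufficesAt := by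
  unfold
    Summit.NavierStokesRegularity.NavierStokesRegularity.Theses.CompletionRelayChain.LocalDynamicsSufficesAt
  intro ε₀ R hε₀ _hR hdyn
  obtain ⟨θ, c, i₀, α, X₀, P, Q, _hθ0, hθ, hc, hα, hX₀, hP, hstep⟩ := hdyn
  exact ⟨α, X₀, hα, noGlobalCascade_of_local (Q := Q) hε₀ hθ hc hX₀ hP hstep⟩

end Summit.NavierStokesRegularity.NavierStokesRegularity.Theorems

end
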